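import Summits.Ventures.PercRepro.ExcessOneMerge
import Summits.Ventures.PercRepro.ExcessOneCompletion

/-!
# The merged pair of a residue instance is again a residue instance

Continuation of `ExcessOneMerge.lean` (the merge lemma (M2)) towards the merge induction on
Conjecture V (proofs/MINE1-theoremS.md, Addenda 11 and 14). Let `(F, u)` be a residue instance
(the hypotheses of `ConjV`: no complementary pair, excess 1, `u, uᶜ ∉ F`, every member signable for
the sign pattern `σ`, neither `F ∪ {u}` nor `F ∪ {uᶜ}` tight), let `r, r'` lie on the same side of
`u`, and write `F'` for the non-separating members and `D'` for the non-separating differences.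
Under (SEP) at the pair (`merge_card_eq`: `|D'| = |F'| + 1`), if moreover

* `F'` is not tight (`(M3)` at the pair), then `D'` is exactly the difference family of `F'`
  (`merge_diffs_eq_of_not_tight`) and `F'` has excess 1;
* some A-only member and some C*-only member of `F` do not separate `r, r'`, then neither
  `F' ∪ {u}` nor `F' ∪ {uᶜ}` is tight (`merge_not_tight_insert`, `merge_not_tight_insert_compl`);

so `(F', u)` satisfies every hypothesis of `ConjV` on the same ground type (with `r, r'` twins of
`F'`) — `merge_residue`. What the induction still needs from the outside is (a) the pair must not
be separated by any bad member (then (SEP) holds there by Theorem Z's counting), (c) = (M3), and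
the transport of Conjecture V along the contraction `r ~ r'` to a smaller ground set.
-/

namespace PercRepro.MSTight

open Finset
open scoped FinsetFamily

variable {α : Type*} [DecidableEq α] [Fintype α]

variable {F : Finset (Finset α)} {r r' : α}

omit [Fintype α] in
/-- If the merged family is not tight, the non-separating differences are exactly its
differences, and it has excess 1. -/
theorem merge_diffs_eq_of_not_tight
    (hcard : ((F \\ F).filter fun x => r ∈ x ↔ r' ∈ x).card =
      (F.filter fun t => r ∈ t ↔ r' ∈ t).card + 1)
    (hnt : ¬ Tight (F.filter fun t => r ∈ t ↔ r' ∈ t)) :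
    (F.filter fun t => r ∈ t ↔ r' ∈ t) \\ (F.filter fun t => r ∈ t ↔ r' ∈ t) =
      (F \\ F).filter fun x => r ∈ x ↔ r' ∈ x := by
  have hsub := merge_diffs_subset (r := r) (r' := r') F
  have hMS := Finset.card_le_card_diffs (F.filter fun t => r ∈ t ↔ r' ∈ t)
  have hle := card_le_card hsub
  have hne : ((F.filter fun t => r ∈ t ↔ r' ∈ t) \\ (F.filter fun t => r ∈ t ↔ r' ∈ t)).card ≠
      (F.filter fun t => r ∈ t ↔ r' ∈ t).card := hnt
  exact eq_of_subset_of_card_le hsub (by omega)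

/-- A non-separating member that is A-signable but not C*-signable in `F` prevents the merged
family from being completed by `u`. -/
theorem merge_not_tight_insert {u : Finset α} (hu : u ∉ F)
    (hcard : ((F \\ F).filter fun x => r ∈ x ↔ r' ∈ x).card =
      (F.filter fun t => r ∈ t ↔ r' ∈ t).card + 1)
    (hnt : ¬ Tight (F.filter fun t => r ∈ t ↔ r' ∈ t))
    {a : Finset α} (ha : a ∈ F) (har : r ∈ a ↔ r' ∈ a)
    (hA : ¬ Cells (F \\ F) a (Finset.univ \ u)) :
    ¬ Tight (insert u (F.filter fun t => r ∈ t ↔ r' ∈ t)) := by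
  have hD := merge_diffs_eq_of_not_tight hcard hnt
  have hex : ((F.filter fun t => r ∈ t ↔ r' ∈ t) \\ (F.filter fun t => r ∈ t ↔ r' ∈ t)).card =
      (F.filter fun t => r ∈ t ↔ r' ∈ t).card + 1 := by rw [hD]; exact hcard
  have hu' : u ∉ (F.filter fun t => r ∈ t ↔ r' ∈ t) := fun h => hu (mem_filter.1 h).1
  rw [tight_insert_iff_of_excess_one hex hu']
  intro h
  have h' := h a (mem_filter.2 ⟨ha, har⟩)
  rw [hD] at h'
  apply hA
  rw [cellsC_iff_sdiff]
  exact ⟨(mem_filter.1 h'.1).1, (mem_filter.1 h'.2).1⟩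

/-- A non-separating member that is C*-signable but not A-signable in `F` prevents the merged
family from being completed by `uᶜ`. -/
theorem merge_not_tight_insert_compl {u : Finset α}
    (huc : Finset.univ \ u ∉ F)
    (hcard : ((F \\ F).filter fun x => r ∈ x ↔ r' ∈ x).card =
      (F.filter fun t => r ∈ t ↔ r' ∈ t).card + 1)
    (hnt : ¬ Tight (F.filter fun t => r ∈ t ↔ r' ∈ t))
    {c : Finset α} (hc : c ∈ F) (hcr : r ∈ c ↔ r' ∈ c) (hC : ¬ Cells (F \\ F) c u) :
    ¬ Tight (insert (Finset.univ \ u) (F.filter fun t => r ∈ t ↔ r' ∈ t)) := by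
  have hD := merge_diffs_eq_of_not_tight hcard hnt
  have hex : ((F.filter fun t => r ∈ t ↔ r' ∈ t) \\ (F.filter fun t => r ∈ t ↔ r' ∈ t)).card =
      (F.filter fun t => r ∈ t ↔ r' ∈ t).card + 1 := by rw [hD]; exact hcard
  have huc' : Finset.univ \ u ∉ (F.filter fun t => r ∈ t ↔ r' ∈ t) := fun h =>
    huc (mem_filter.1 h).1
  rw [tight_insert_iff_of_excess_one hex huc']
  intro h
  have h' := h c (mem_filter.2 ⟨hc, hcr⟩)
  rw [hD] at h'
  apply hC
  rw [cellsA_iff_sdiff]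
  exact ⟨(mem_filter.1 h'.1).1, (mem_filter.1 h'.2).1⟩

/-- **The merged pair is a residue instance.** Under (SEP) at a same-side pair `r, r'`, with the
merged family not tight and with a non-separating A-only and a non-separating C*-only member,
`(F', u)` satisfies every hypothesis of Conjecture V (`ConjV`) on the same ground type. -/
theorem merge_residue (σ : Finset α → Bool) {u : Finset α}
    (hval : Disjoint F (compls F)) (hex : (F \\ F).card = F.card + 1) (hu : u ∉ F)
    (huc : Finset.univ \ u ∉ F)
    (hcells : ∀ t ∈ F, Cells (F \\ F) t (if σ t = true then u else Finset.univ \ u))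
    (hur : r ∈ u ↔ r' ∈ u)
    (hsep : (F.filter fun t => ¬ (r ∈ t ↔ r' ∈ t)).card ≤
      ((F \\ F).filter fun x => ¬ (r ∈ x ↔ r' ∈ x)).card)
    (hnt : ¬ Tight (F.filter fun t => r ∈ t ↔ r' ∈ t))
    {a : Finset α} (ha : a ∈ F) (har : r ∈ a ↔ r' ∈ a)
    (hA : ¬ Cells (F \\ F) a (Finset.univ \ u))
    {c : Finset α} (hc : c ∈ F) (hcr : r ∈ c ↔ r' ∈ c) (hC : ¬ Cells (F \\ F) c u) :
    Disjoint (F.filter fun t => r ∈ t ↔ r' ∈ t) (compls (F.filter fun t => r ∈ t ↔ r' ∈ t)) ∧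
    ((F.filter fun t => r ∈ t ↔ r' ∈ t) \\ (F.filter fun t => r ∈ t ↔ r' ∈ t)).card =
      (F.filter fun t => r ∈ t ↔ r' ∈ t).card + 1 ∧
    u ∉ (F.filter fun t => r ∈ t ↔ r' ∈ t) ∧
    Finset.univ \ u ∉ (F.filter fun t => r ∈ t ↔ r' ∈ t) ∧
    (∀ t ∈ (F.filter fun t => r ∈ t ↔ r' ∈ t),
      Cells ((F.filter fun t => r ∈ t ↔ r' ∈ t) \\ (F.filter fun t => r ∈ t ↔ r' ∈ t)) t
        (if σ t = true then u else Finset.univ \ u)) ∧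
    ¬ Tight (insert u (F.filter fun t => r ∈ t ↔ r' ∈ t)) ∧
    ¬ Tight (insert (Finset.univ \ u) (F.filter fun t => r ∈ t ↔ r' ∈ t)) := by
  have hF' : (F.filter fun t => r ∈ t ↔ r' ∈ t) ⊆ F := filter_subset _ _
  have hne : (F.filter fun t => r ∈ t ↔ r' ∈ t).Nonempty := ⟨a, mem_filter.2 ⟨ha, har⟩⟩
  have hcard := merge_card_eq σ hval hex hu huc hcells hur hsep hne
  have hD := merge_diffs_eq_of_not_tight hcard hnt
  refine ⟨hval.mono hF' (compls_subset_compls hF'), by rw [hD]; exact hcard,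
    fun h => hu (hF' h), fun h => huc (hF' h), ?_,
    merge_not_tight_insert hu hcard hnt ha har hA,
    merge_not_tight_insert_compl huc hcard hnt hc hcr hC⟩
  intro t ht
  obtain ⟨htF, htr⟩ := mem_filter.1 ht
  rw [hD]
  refine merge_cells htr ?_ (hcells t htF)
  by_cases hσ : σ t = true
  · rw [if_pos hσ]; exact hur
  · rw [if_neg hσ]; exact nonsep_compl hur

end PercRepro.MSTight
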